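import Literature.Analysis.FluidPDE.SelfSimilarLiouville
import Literature.Analysis.FluidPDE.WeakSolutionProofs
import HarnessLib

/-!
# Bounded weak solutions and the Liouville theorems of Koch–Nadirashvili–Seregin–Šverák

Trunk T-FLUID (`Literature/Analysis/FluidPDE`), family NS (ns.S22, the Liouville problem for
bounded ancient solutions); companion of `Literature.Analysis.FluidPDE.SelfSimilarLiouville`,
whose named facts `Literature.Analysis.FluidPDE.knss_axisymmetric_no_swirl` and `Literature.Analysis.FluidPDE.knss_bound_C_over_r` render
Theorems 5.2 and 5.3 of Koch–Nadirashvili–Seregin–Šverák (KNSS), Acta Math. 203 (2009) =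
arXiv:0709.3599, in the accepted *duality-form* class `Fluid.IsBoundedAncientMildSolution`
(two-time identity between all `s < t < 0`, slices measurable and determined a.e.).

The source states and proves its Liouville theorems in a different class, its own: **bounded
weak solutions**, `u ∈ L^∞(ℝⁿ × (t₁, t₂))` with `div u = 0` in distributions and
`∫∫ u·(∂ₜφ + Δφ) dx dt = -∫∫ u_k u·∂_k φ dx dt` for every smooth compactly supported
*divergence-free* space–time field `φ` (arXiv:0709.3599, §3, p. 7, the definition before
Lemma 3.1, for the Stokes system with right-hand side `∂_k f_k`; §4, p. 8, (ii), with
`f_k = -u_k u`). This file vendors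

* that class, `Literature.Fluid.IsBoundedWeakNSSolutionOn I hI ν u` (on the open slab `I × E` over an
  open set of times `I`, viscosity `ν`; KNSS have `ν = 1`), with its projections, the zero
  solution and the restriction to a smaller time set (`IsBoundedWeakNSSolutionOn.mono`, proved as
  for the accepted `Fluid.IsWeakNSSolutionOn.mono_holds`);
* KNSS's three Liouville theorems **as printed**, for that class, as named facts:
  `Literature.Analysis.FluidPDE.KNSS2009_liouville_planar` (Theorem 5.1: in `ℝ²`, `u(x,t) = b(t)`),
  `Literature.Analysis.FluidPDE.KNSS2009_liouville_axisymmetric_no_swirl` (Theorem 5.2: in `ℝ³`, axisymmetric without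
  swirl, `u(x,t) = (0, 0, b₃(t))`), `Literature.Analysis.FluidPDE.KNSS2009_liouville_bound_C_over_r` (Theorem 5.3: in
  `ℝ³`, axisymmetric with `|u| ≤ C/√(x₁² + x₂²)`, `u = 0`);
* with real proofs: the last line of the printed proof of Theorem 5.3 ("the solution `u` is
  swirl-free and we can apply Theorem 5.2 to conclude that `u = 0`", arXiv p. 10) in both
  classes — `KNSS2009_liouville_axisymmetric_no_swirl.ae_eq_zero_of_bound` and, for the
  duality-form facts of `SelfSimilarLiouville`, `knss_axisymmetric_no_swirl.ae_eq_zero_of_bound`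
  — resting on the measure-theoretic lemma `Fluid.eq_zero_of_ae_eq_const_of_cylRadius_mul_norm_le`
  (a slice a.e. equal to a constant `b` and obeying `r ‖u‖ ≤ C` a.e. has `b = 0`); the special
  cases of Theorems 5.2–5.3 for representatives satisfying the symmetry and decay hypotheses
  pointwise at every `t < 0` (`…of_pointwise`, the hypotheses' shape of `SelfSimilarLiouville`);
  and the space–time form `u = 0` a.e. on `(−∞, 0) × ℝ³` of the conclusion of Theorem 5.3
  (`ae_eq_zero_slab_of_ae_slice`, `KNSS2009_liouville_bound_C_over_r.ae_eq_zero_slab`).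

## Why this file (plan for `knss_bound_C_over_r_holds`)

The duality-form fact `NS.knss_bound_C_over_r` is Theorem 5.3 transported to the tree's mild
class; its proof is (i) a *bridge*, specific to the tree and provable from the definitions — a
bounded ancient mild solution with measurable slices, axisymmetric with `r‖u‖ ≤ C`, yields a
bounded weak solution `w` on `(−∞, 0) × ℝ³` in the sense below, axisymmetric with the same
bound, such that the conclusion `w t =ᵐ 0` for a.e. `t` transfers back to `u t =ᵐ 0` for every
`t < 0` (the pairings `t ↦ ∫⟪u t, φ⟫` with divergence-free tests are continuous by the two-time
identity, whether or not the Bochner time integral of the nonlinear term takes its junk value,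
since that term is `O(t - s)` in both cases) — followed by (ii) **the theorem in print**,
`KNSS2009_liouville_bound_C_over_r`. Step (ii) is deep: the printed proof (arXiv p. 10) uses the
regularity theory of §4 ((4.6)–(4.7): bounded weak solutions are smooth in `x` with bounded
derivatives, via Lemma 3.1 and the Oseen-kernel estimates (3.7)–(3.10)), the stability lemma for
the strong maximum principle (Lemma 2.1, p. 5), the Navier–Stokes scaling applied to `f = r u_θ`
and its equation `f_t + u·∇f = Δf - (2/r) f_{,r}`, a cut-off computation giving
`sup f ≤ 0 ≤ inf f`, and Theorem 5.2 (whose proof, pp. 9–10, runs the same scheme on `ω_θ / r`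
with the five-dimensional Laplacian and ends with the Liouville theorem for `curl u = 0`,
`div u = 0`). None of these ingredients is in Mathlib or in the tree yet; they are the next named
facts to vendor (KNSS 2009, Lemma 2.1, Lemma 3.1, (4.6)–(4.7)).

## Rendering choices

* `u ∈ L^∞(ℝⁿ × I)` for everywhere-defined fields `u : ℝ → E → E`: `uncurry u` is a.e. strongly
  measurable on `I × E` and `Fluid.IsBoundedOn I u` (a pointwise bound on the chosen
  representative; every `L^∞` class has such a representative, and the remaining clauses are
  invariant under modification of `u` on a null subset of `I × E`, the divergence clause because
  a.e. time slice of a null set is null).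
* "`div u = 0` in `ℝⁿ × I` in the sense of distributions" is rendered slice-wise for a.e. time,
  `∀ᵐ t ∈ I, Fluid.IsWeaklyDivFree (u t)`, the form of the accepted `Fluid.IsWeakNSSolutionOn`;
  for locally integrable `u` the two are equivalent (Fubini; the converse is
  `Fluid.ae_isWeaklyDivFree_of_forall_test` of `DistributionalToWeak`).
* The identity is KNSS's with everything on one side and the viscosity explicit:
  `∫_I ∫ (⟪u, ∂ₜψ⟫ + ⟪u, (u·∇)ψ⟫ + ν⟪u, Δψ⟫) dx dt = 0` for all `ψ ∈ C_c^∞(I × E; E)` with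
  `div ψ(t, ·) = 0` for every `t` (`Fluid.IsSpaceTimeTestOn (Fluid.slab E I hI) ψ`; the pairing
  of `-u_k u ∂_k φ` with the implicit sum is `-⟪u, (u·∇)φ⟫`, `Fluid.convect`). As KNSS stress
  (§1, p. 3), this class contains the "parasitic" solutions `u(x, t) = b(t)`, which is why
  Theorems 5.1–5.2 conclude `u = b(t)` and not `u = const`.
* The hypotheses of Theorems 5.2–5.3 ("`u` is axi-symmetric", "with no swirl",
  "`|u(x,t)| ≤ C/√(x₁² + x₂²)` in `ℝ³ × (−∞, 0)`") concern an `L^∞` function and are rendered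
  almost everywhere: for every angle `θ`, `u(t, R_θ x) = R_θ u(t, x)` for a.e. `x`, for a.e.
  `t < 0` (`Fluid.rotZ`, the axis being the `x₃`-axis as in the accepted vocabulary — KNSS: "a
  suitable axis, which is often identified with the `x₃`-coordinate axis"); `Fluid.swirl (u t) = 0`
  a.e. for a.e. `t`; and the bound, junk-free as `cylRadius x * ‖u t x‖ ≤ C` exactly as in
  `NS.knss_bound_C_over_r`, for a.e. `x` and a.e. `t`. (KNSS verify them pointwise for the smooth
  representative of §4, for which the two readings agree; the pointwise-at-every-`t < 0` versions
  for a given representative are the proved special cases `…of_pointwise`.) Conclusions are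
  likewise almost everywhere: "`u(x,t) = b(t)` for a bounded measurable `b`" is
  `u t =ᵐ fun _ => b t` for a.e. `t < 0`, and "`u = 0` in `ℝ³ × (−∞, 0)`" is `u t =ᵐ 0` for a.e.
  `t < 0`, equivalently `u = 0` a.e. on the slab (`…ae_eq_zero_slab`, proved). The weak
  formulation does not see individual slices, so nothing can be concluded at *every* `t`.
* The facts take `ν = 1` as in print (KNSS (1.1)).

## References

* G. Koch, N. Nadirashvili, G. Seregin, V. Šverák, *Liouville theorems for the Navier–Stokes
  equations and applications*, Acta Math. 203 (2009) 83–105 = arXiv:0709.3599 (arXiv page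
  numbers): §1 p. 3 (mild versus weak solutions, parasitic solutions `b(t)`); §2 Lemma 2.1 p. 5;
  §3 p. 7 (weak solutions of the Stokes system, Lemma 3.1); §4 p. 8 ((i) mild and (ii) weak
  solutions of Navier–Stokes, (4.6)–(4.7)); §5 pp. 9–10, Theorems 5.1, 5.2, 5.3 with proofs.
  [KochNadirashviliSereginSverak2009]
* G. Seregin, V. Šverák, *On Type I singularities of the local axi-symmetric solutions of the
  Navier–Stokes equations*, Comm. PDE 34 (2009), §1 (the Liouville conjecture for bounded
  ancient mild solutions). [SereginSverak2009]
-/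

noncomputable section

open MeasureTheory Set Function Filter Topology TopologicalSpace
open scoped Laplacian InnerProductSpace RealInnerProductSpace NNReal ENNReal

namespace Literature.Analysis.FluidPDE

section Fluid

/-! ### Bounded weak solutions on an open slab (KNSS 2009, §§3–4) -/

section BoundedWeak

variable {E : Type*} [NormedAddCommGroup E] [InnerProductSpace ℝ E] [FiniteDimensional ℝ E]
  [MeasurableSpace E] [BorelSpace E]

/-- **Bounded weak solutions of the Navier–Stokes equations** on `ℝⁿ × I`, `I` an open set of
times (Koch–Nadirashvili–Seregin–Šverák 2009, §4, arXiv:0709.3599 p. 8, (ii), with the weak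
Stokes formulation of §3, p. 7: "a bounded measurable vector field `u : ℝⁿ × (0,T) → ℝⁿ` is a
weak solution if `div u = 0` in `ℝⁿ × (0,T)` (in the sense of distributions) and
`∫₀ᵀ∫ u(φ_t + Δφ) dx dt = ∫₀ᵀ∫ -u_k u ∂_k φ dx dt` for each `φ ∈ 𝒱_T`", `𝒱_T` the smooth
compactly supported divergence-free fields on `ℝⁿ × (0,T)`). For the viscosity `ν` (KNSS:
`ν = 1`) and `u : ℝ → E → E` (time first): `u` is a.e. strongly measurable and bounded on the
slab `I × E`, `u t` is weakly divergence free for a.e. `t ∈ I`, and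
`∫_I ∫ (⟪u, ∂ₜψ⟫ + ⟪u, (u·∇)ψ⟫ + ν ⟪u, Δψ⟫) dx dt = 0` for every smooth compactly supported
`ψ` on the open slab `I × E` with divergence-free slices. No datum, no pressure, no force; the
class contains the parasitic solutions `u(x,t) = b(t)` (KNSS §1). See the module docstring for
the rendering of `L^∞` and of the distributional divergence constraint. [cite: KochNadirashviliSereginSverak2009, §4 p. 8 (ii) and §3 p. 7 (arXiv:0709.3599)] -/
def IsBoundedWeakNSSolutionOn (I : Set ℝ) (hI : IsOpen I) (ν : ℝ) (u : ℝ → E → E) : Prop :=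
  AEStronglyMeasurable (uncurry u) (volume.restrict (I ×ˢ univ)) ∧
    IsBoundedOn I u ∧
    (∀ᵐ t ∂(volume.restrict I), IsWeaklyDivFree (u t)) ∧
    ∀ ψ : ℝ → E → E, IsSpaceTimeTestOn (slab E I hI) ψ → (∀ t, VectorCalculus.IsDivFree (ψ t)) →
      ∫ t in I, ∫ x, (⟪u t x, timeDeriv ψ t x⟫ + ⟪u t x, convect (u t) (ψ t) x⟫ +
        ν * ⟪u t x, Δ (ψ t) x⟫) = 0

namespace IsBoundedWeakNSSolutionOn

variable {I : Set ℝ} {hI : IsOpen I} {ν : ℝ} {u : ℝ → E → E}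

/-- A bounded weak solution is a.e. strongly measurable on its slab (projection). [folklore] -/
theorem aestronglyMeasurable (h : IsBoundedWeakNSSolutionOn I hI ν u) :
    AEStronglyMeasurable (uncurry u) (volume.restrict (I ×ˢ univ)) :=
  h.1

/-- A bounded weak solution is bounded on its time set (projection). [folklore] -/
theorem isBoundedOn (h : IsBoundedWeakNSSolutionOn I hI ν u) : IsBoundedOn I u :=
  h.2.1

/-- The slices of a bounded weak solution are weakly divergence free for a.e. time
(projection; KNSS 2009, §4 (ii): `div u = 0` in distributions). [cite: KochNadirashviliSereginSverak2009, §4 p. 8 (ii)] -/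
theorem ae_isWeaklyDivFree (h : IsBoundedWeakNSSolutionOn I hI ν u) :
    ∀ᵐ t ∂(volume.restrict I), IsWeaklyDivFree (u t) :=
  h.2.2.1

/-- The weak Navier–Stokes identity against a divergence-free space–time test field
(projection; KNSS 2009, §4 (ii)). [cite: KochNadirashviliSereginSverak2009, §4 p. 8 (ii)] -/
theorem integral_eq_zero (h : IsBoundedWeakNSSolutionOn I hI ν u) {ψ : ℝ → E → E}
    (hψ : IsSpaceTimeTestOn (slab E I hI) ψ) (hdiv : ∀ t, VectorCalculus.IsDivFree (ψ t)) :
    ∫ t in I, ∫ x, (⟪u t x, timeDeriv ψ t x⟫ + ⟪u t x, convect (u t) (ψ t) x⟫ +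
        ν * ⟪u t x, Δ (ψ t) x⟫) = 0 :=
  h.2.2.2 ψ hψ hdiv

/-- **Restriction in time.** A bounded weak solution on `ℝⁿ × I` is a bounded weak solution on
`ℝⁿ × J` for every open `J ⊆ I` (KNSS 2009, Remark 4.1: the notion "is also well defined" on
sub-intervals). Measurability, the bound and the divergence constraint restrict; a test field
supported in `J × E` is one supported in `I × E`, and its slices, time derivative, spatial
derivative and Laplacian vanish at every `(t, x)` with `t ∈ I ∖ J`, so `∫_I = ∫_J`
(`setIntegral_eq_of_subset_of_forall_sdiff_eq_zero`, as in `IsWeakNSSolutionOn.mono_holds`). [cite: KochNadirashviliSereginSverak2009, §4 Remark 4.1] -/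
theorem mono (h : IsBoundedWeakNSSolutionOn I hI ν u) {J : Set ℝ} (hJ : IsOpen J)
    (hJI : J ⊆ I) : IsBoundedWeakNSSolutionOn J hJ ν u := by
  obtain ⟨hmeas, hbdd, hdiv, hweak⟩ := h
  have hsub' : J ×ˢ (univ : Set E) ⊆ I ×ˢ univ := prod_mono hJI Subset.rfl
  refine ⟨hmeas.mono_measure (Measure.restrict_mono hsub' le_rfl), hbdd.mono hJI,
    ae_mono (Measure.restrict_mono hJI le_rfl) hdiv, fun ψ hψ hψdiv => ?_⟩
  have hψI : IsSpaceTimeTestOn (slab E I hI) ψ := hψ.mono (slab_mono hJI)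
  have key := hweak ψ hψI hψdiv
  rw [setIntegral_eq_of_subset_of_forall_sdiff_eq_zero hI.measurableSet hJI] at key
  · exact key
  · intro t ht
    have hz : ∀ x : E, (t, x) ∉ ((slab E J hJ : Opens (ℝ × E)) : Set (ℝ × E)) :=
      fun x hx => ht.2 (mem_slab.1 (SetLike.mem_coe.1 hx))
    have h1 : ∀ x, deriv (fun s => ψ s x) t = 0 := fun x => hψ.deriv_eq_zero (hz x)
    have h2 : ∀ x, fderiv ℝ (ψ t) x = 0 := fun x => hψ.fderiv_slice_eq_zero (hz x)
    have h3 : ∀ x, Δ (ψ t) x = 0 := fun x => hψ.laplacian_slice_eq_zero (hz x)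
    simp [h1, convect, h2, h3]

end IsBoundedWeakNSSolutionOn

/-- The zero field is a bounded weak solution on every open slab (all integrands vanish).
[folklore] -/
theorem isBoundedWeakNSSolutionOn_zero (I : Set ℝ) (hI : IsOpen I) (ν : ℝ) :
    IsBoundedWeakNSSolutionOn I hI ν (0 : ℝ → E → E) := by
  refine ⟨?_, ⟨0, fun t _ x => by simp⟩, Eventually.of_forall fun t θ _ => by simp,
    fun ψ _ _ => by simp⟩
  exact (aestronglyMeasurable_const : AEStronglyMeasurable (fun _ : ℝ × E => (0 : E)) _)

end BoundedWeak

/-! ### A slice a.e. equal to a constant and decaying like `C / r` vanishes -/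

section Decay

/-- Local notation for physical space `ℝ³ = EuclideanSpace ℝ (Fin 3)`. -/
local notation "ℝ³" => EuclideanSpace ℝ (Fin 3)

/-- If a field `v : ℝ³ → ℝ³` is a.e. equal to a constant `b` and satisfies the junk-free decay
bound `r ‖v x‖ ≤ C` almost everywhere (`r = cylRadius x`), then `b = 0`: otherwise the unit ball
around `(|C|/‖b‖ + 2, 0, 0)`, on which `r > |C|/‖b‖ + 1` and hence `r ‖b‖ > C`, would be a null
set (the measure-theoretic content of the last sentence of the proof of KNSS 2009, Theorem 5.3,
arXiv:0709.3599 p. 10: Theorem 5.2 gives `u = (0, 0, b₃(t))` and the bound `|u| ≤ C/r` forces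
`b₃ = 0`). [cite: KochNadirashviliSereginSverak2009, proof of Thm 5.3, last paragraph (arXiv p. 10)] -/
theorem eq_zero_of_ae_eq_const_of_cylRadius_mul_norm_le {v : ℝ³ → ℝ³} {b : ℝ³} {C : ℝ}
    (hv : v =ᵐ[volume] fun _ => b) (hb : ∀ᵐ x ∂(volume : Measure ℝ³), cylRadius x * ‖v x‖ ≤ C) :
    b = 0 := by
  by_contra hb0
  have hbpos : 0 < ‖b‖ := norm_pos_iff.2 hb0
  -- a.e. the constant itself obeys the bound
  have H : ∀ᵐ x ∂(volume : Measure ℝ³), cylRadius x * ‖b‖ ≤ C := by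
    filter_upwards [hv, hb] with x hx hbx
    rwa [hx] at hbx
  set R : ℝ := |C| / ‖b‖ + 2 with hR
  set x₀ : ℝ³ := EuclideanSpace.single 0 R with hx₀
  -- on the unit ball around `x₀` the bound fails
  have hball : Metric.ball x₀ 1 ⊆ {x | ¬ cylRadius x * ‖b‖ ≤ C} := by
    intro x hx hle
    have hdist : ‖x - x₀‖ < 1 := by rwa [Metric.mem_ball, dist_eq_norm] at hx
    have hcoord : |x 0 - R| < 1 := by
      have h1 : |(x - x₀) 0| ≤ ‖x - x₀‖ := by
        simpa only [Real.norm_eq_abs] using PiLp.norm_apply_le (x - x₀) 0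
      have h2 : (x - x₀) 0 = x 0 - R := by simp [hx₀]
      rw [h2] at h1
      exact lt_of_le_of_lt h1 hdist
    have hx0 : R - 1 < x 0 := by
      have := (abs_lt.1 hcoord).1
      linarith
    have hRpos : 0 < R - 1 := by
      have : 0 ≤ |C| / ‖b‖ := div_nonneg (abs_nonneg C) hbpos.le
      linarith
    have hx0pos : 0 < x 0 := lt_trans hRpos hx0
    have hrad : x 0 ≤ cylRadius x := by
      have h := Real.sqrt_le_sqrt
        (le_add_of_nonneg_right (sq_nonneg (x 1)) : x 0 ^ 2 ≤ x 0 ^ 2 + x 1 ^ 2)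
      rwa [Real.sqrt_sq hx0pos.le] at h
    have h3 : (R - 1) * ‖b‖ < cylRadius x * ‖b‖ :=
      mul_lt_mul_of_pos_right (lt_of_lt_of_le hx0 hrad) hbpos
    have h4 : (R - 1) * ‖b‖ = |C| + ‖b‖ := by
      rw [hR]
      field_simp
      ring
    have h5 : C ≤ |C| := le_abs_self C
    have h6 : cylRadius x * ‖b‖ ≤ C := hle
    linarith
  have hnull : volume {x | ¬ cylRadius x * ‖b‖ ≤ C} = 0 := ae_iff.1 H
  have hzero : volume (Metric.ball x₀ 1) = 0 := measure_mono_null hball hnull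
  exact (Metric.measure_ball_pos volume x₀ one_pos).ne' hzero

/-- A slice a.e. equal to a constant multiple `β • e_z` of the axial unit vector and obeying
`r ‖v x‖ ≤ C` a.e. has `β = 0` (the case `b = β • e_z` of
`eq_zero_of_ae_eq_const_of_cylRadius_mul_norm_le`; KNSS 2009, end of the proof of Thm 5.3). [cite: KochNadirashviliSereginSverak2009, proof of Thm 5.3, last paragraph (arXiv p. 10)] -/
theorem smul_eZ_eq_zero_of_ae_eq_of_cylRadius_mul_norm_le {v : ℝ³ → ℝ³} {β C : ℝ}
    (hv : v =ᵐ[volume] fun _ => β • eZ)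
    (hb : ∀ᵐ x ∂(volume : Measure ℝ³), cylRadius x * ‖v x‖ ≤ C) : β = 0 := by
  have h := eq_zero_of_ae_eq_const_of_cylRadius_mul_norm_le hv hb
  have heZ : (eZ : ℝ³) ≠ 0 := by
    intro h0
    have : (eZ : ℝ³) 2 = 0 := by rw [h0]; rfl
    simp [eZ] at this
  exact (smul_eq_zero.1 h).resolve_right heZ

end Decay

end Fluid

section NS

/-- Local notation for physical space `ℝ³ = EuclideanSpace ℝ (Fin 3)`. -/
local notation "ℝ³" => EuclideanSpace ℝ (Fin 3)

/-- Local notation for the plane `ℝ² = EuclideanSpace ℝ (Fin 2)`. -/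
local notation "ℝ²" => EuclideanSpace ℝ (Fin 2)

/-! ### KNSS 2009, Theorems 5.1–5.3, as printed (bounded weak solutions) -/

/-- **KNSS 2009, Theorem 5.1** (Liouville theorem in two space dimensions; Acta Math. 203 (2009)
= arXiv:0709.3599, §5, p. 9: "Let `u` be a bounded weak solution of the Navier–Stokes equations
in `ℝ² × (−∞, 0)`. Then `u(x,t) = b(t)` for a suitable bounded measurable
`b : (−∞, 0) → ℝ²`"). For every bounded weak solution `u` (`ν = 1`,
`Fluid.IsBoundedWeakNSSolutionOn`) on `ℝ² × (−∞, 0)` there is a bounded measurable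
`b : ℝ → ℝ²` with `u(t, ·) = b(t)` a.e. in `x`, for a.e. `t < 0` (the rendering of an identity
between `L^∞` functions; module docstring). Proof in print: the scalar vorticity
`ω = u_{2,1} - u_{1,2}` is bounded with its derivatives (§4) and solves `ω_t + u·∇ω - Δω = 0`;
if `sup ω > 0`, Lemma 2.1 produces parabolic balls `Q_R` of arbitrary radius with `ω ≥ sup ω / 2`,
contradicting `∫_{Q_R} ω = ∫ (u₂n₁ - u₁n₂) ≤ C R³`; so `ω ≡ 0`, and `curl u = 0`, `div u = 0`, `u`
bounded give `u` constant in `x`. [cite: KochNadirashviliSereginSverak2009, Thm 5.1 (arXiv p. 9)] -/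
def KNSS2009_liouville_planar : Prop :=
  ∀ ⦃u : ℝ → ℝ² → ℝ²⦄, FluidPDE.IsBoundedWeakNSSolutionOn (Iio 0) isOpen_Iio 1 u →
    ∃ b : ℝ → ℝ², Measurable b ∧ (∃ C : ℝ, ∀ t, ‖b t‖ ≤ C) ∧
      ∀ᵐ t ∂(volume.restrict (Iio (0 : ℝ))), u t =ᵐ[volume] fun _ => b t

/-- **KNSS 2009, Theorem 5.2** (Liouville theorem for axisymmetric bounded ancient weak
solutions without swirl; Acta Math. 203 (2009) = arXiv:0709.3599, §5, pp. 9–10: "Let `u` be a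
bounded weak solution of the Navier–Stokes equations in `ℝ³ × (−∞, 0)`. Assume that `u` is
axi-symmetric with no swirl. Then `u(x,t) = (0, 0, b₃(t))` for some bounded measurable function
`b₃ : (−∞, 0) → ℝ`"). For every bounded weak solution `u` (`ν = 1`) on `ℝ³ × (−∞, 0)` which is
axisymmetric about the `x₃`-axis — as an `L^∞` function: for every angle `θ`,
`u(t, R_θ x) = R_θ u(t, x)` for a.e. `x`, for a.e. `t < 0` (`Fluid.rotZ`) — and swirl-free —
`Γ = r u_θ = x₀u₁ − x₁u₀ = 0` a.e. (`Fluid.swirl`) for a.e. `t < 0` —, there is a bounded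
measurable `b : ℝ → ℝ` with `u(t, ·) = b(t) e_z` a.e. in `x` for a.e. `t < 0` (the axis is fixed
to be the `x₃`-axis, as in the accepted vocabulary; KNSS: "a suitable axis, which is often
identified with the `x₃`-coordinate axis"; pointwise hypotheses on a representative are the
special case `…of_pointwise`). Proof in print: `ω_θ / r` is bounded with its derivatives (§4,
Remark 5.1), solves `(ω_θ/r)_t + u_r (ω_θ/r)_{,r} + u_z (ω_θ/r)_{,z} = Δ₅ (ω_θ/r)` (the
`SO(4)`-invariant five-dimensional Laplacian), Lemma 2.1 forces `sup (ω_θ/r) ≤ 0 ≤ inf (ω_θ/r)`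
as in Theorem 5.1, so `ω = 0`, and the Liouville theorem for `curl u = 0`, `div u = 0` ends the
proof. KNSS add (p. 10) that the statement without the no-swirl assumption is open. [cite: KochNadirashviliSereginSverak2009, Thm 5.2 (arXiv pp. 9–10)] -/
def KNSS2009_liouville_axisymmetric_no_swirl : Prop :=
  ∀ ⦃u : ℝ → ℝ³ → ℝ³⦄, FluidPDE.IsBoundedWeakNSSolutionOn (Iio 0) isOpen_Iio 1 u →
    (∀ θ : ℝ, ∀ᵐ t ∂(volume.restrict (Iio (0 : ℝ))),
      (fun x => u t (FluidPDE.rotZ θ x)) =ᵐ[volume] fun x => FluidPDE.rotZ θ (u t x)) →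
    (∀ᵐ t ∂(volume.restrict (Iio (0 : ℝ))), FluidPDE.swirl (u t) =ᵐ[volume] (0 : ℝ³ → ℝ)) →
    ∃ b : ℝ → ℝ, Measurable b ∧ (∃ C : ℝ, ∀ t, |b t| ≤ C) ∧
      ∀ᵐ t ∂(volume.restrict (Iio (0 : ℝ))), u t =ᵐ[volume] fun _ => b t • FluidPDE.eZ

/-- **KNSS 2009, Theorem 5.3** (Liouville theorem under the bound `|u| ≤ C/r`; Acta Math. 203
(2009) = arXiv:0709.3599, §5, p. 10: "Let `u` be a bounded weak solution of the Navier–Stokes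
equations in `ℝ³ × (−∞, 0)`. Assume that `u` is axi-symmetric and, in addition, satisfies
`|u(x,t)| ≤ C/√(x₁² + x₂²)` in `ℝ³ × (−∞, 0)`. Then `u = 0` in `ℝ³ × (−∞, 0)`"). For every
bounded weak solution `u` (`ν = 1`) on `ℝ³ × (−∞, 0)` which is axisymmetric about the `x₃`-axis
as an `L^∞` function (for every `θ`, `u(t, R_θ x) = R_θ u(t, x)` for a.e. `x`, for a.e. `t < 0`)
and satisfies `r ‖u(t, x)‖ ≤ C` for a.e. `x`, for a.e. `t < 0` (the junk-free form of
`|u| ≤ C/r`, vacuous on the axis as in print), `u(t, ·) = 0` a.e. in `x` for a.e. `t < 0`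
(`u = 0` in `L^∞(ℝ³ × (−∞, 0))`; space–time form `…ae_eq_zero_slab`, pointwise-hypotheses form
`…of_pointwise`). This is the printed theorem behind the duality-form fact
`NS.knss_bound_C_over_r` (module docstring, "Why this file"). Proof in print: with `f = r u_θ`,
`f_t + u_r f_{,r} + u_z f_{,z} = Δf - (2/r) f_{,r}`; the rescalings `f^λ(x,t) = f(λx, λ²t)`,
`u^λ = λu(λx, λ²t)` satisfy `|f^λ| ≤ C`, `|u^λ| ≤ C/r` uniformly in `λ`; if `M = sup f > 0`,
Lemma 2.1 and a rescaling make `f^λ ≥ M - ε` on a large region near the axis, and testing the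
equation with an axisymmetric cut-off `φ = ξ(r)η(z)ζ(t)` gives `|I| + |II| + |III| ≤
C(Lδ² + δT₁) + O(ε)` against `-∫ (2/r) f^λ_{,r} φ ≤ -8πMLT₁ + C T₁ + C L + O(ε)`, a contradiction
for `L, T₁` large; so `sup f ≤ 0`, likewise `inf f ≥ 0`, `u` is swirl-free, and Theorem 5.2 with
the bound gives `u = 0` (`KNSS2009_liouville_axisymmetric_no_swirl.ae_eq_zero_of_bound`). [cite: KochNadirashviliSereginSverak2009, Thm 5.3 (arXiv p. 10)] -/
def KNSS2009_liouville_bound_C_over_r : Prop :=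
  ∀ ⦃u : ℝ → ℝ³ → ℝ³⦄, FluidPDE.IsBoundedWeakNSSolutionOn (Iio 0) isOpen_Iio 1 u →
    (∀ θ : ℝ, ∀ᵐ t ∂(volume.restrict (Iio (0 : ℝ))),
      (fun x => u t (FluidPDE.rotZ θ x)) =ᵐ[volume] fun x => FluidPDE.rotZ θ (u t x)) →
    (∃ C : ℝ, ∀ᵐ t ∂(volume.restrict (Iio (0 : ℝ))), ∀ᵐ x ∂(volume : Measure ℝ³),
      FluidPDE.cylRadius x * ‖u t x‖ ≤ C) →
      ∀ᵐ t ∂(volume.restrict (Iio (0 : ℝ))), u t =ᵐ[volume] 0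

/-! ### Pointwise hypotheses on a representative (the shape of `SelfSimilarLiouville`) -/

/-- Pointwise axisymmetry of the slices at every `t < 0` implies the a.e. form used in the
printed-class facts. [folklore] -/
theorem ae_rotZ_of_isAxisymmetric {u : ℝ → ℝ³ → ℝ³} (haxi : ∀ t < 0, FluidPDE.IsAxisymmetric (u t))
    (θ : ℝ) : ∀ᵐ t ∂(volume.restrict (Iio (0 : ℝ))),
      (fun x => u t (FluidPDE.rotZ θ x)) =ᵐ[volume] fun x => FluidPDE.rotZ θ (u t x) := by
  filter_upwards [ae_restrict_mem measurableSet_Iio] with t ht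
  exact Eventually.of_forall fun x => haxi t ht θ x

/-- A pointwise swirl-free family of slices is a.e. swirl-free. [folklore] -/
theorem ae_swirl_of_hasNoSwirl {u : ℝ → ℝ³ → ℝ³} (hswirl : ∀ t < 0, FluidPDE.HasNoSwirl (u t)) :
    ∀ᵐ t ∂(volume.restrict (Iio (0 : ℝ))), FluidPDE.swirl (u t) =ᵐ[volume] (0 : ℝ³ → ℝ) := by
  filter_upwards [ae_restrict_mem measurableSet_Iio] with t ht
  exact Eventually.of_forall fun x => hswirl t ht x

/-- A pointwise decay bound `r ‖u(t,x)‖ ≤ C` at every `t < 0` implies its a.e. form. [folklore] -/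
theorem ae_cylRadius_mul_norm_le_of_forall {u : ℝ → ℝ³ → ℝ³} {C : ℝ}
    (hC : ∀ t < 0, ∀ x, FluidPDE.cylRadius x * ‖u t x‖ ≤ C) :
    ∀ᵐ t ∂(volume.restrict (Iio (0 : ℝ))), ∀ᵐ x ∂(volume : Measure ℝ³),
      FluidPDE.cylRadius x * ‖u t x‖ ≤ C := by
  filter_upwards [ae_restrict_mem measurableSet_Iio] with t ht
  exact Eventually.of_forall (hC t ht)

/-- **Theorem 5.2 for a pointwise axisymmetric, pointwise swirl-free representative** (the
hypotheses' shape of `NS.knss_axisymmetric_no_swirl`): a special case of the printed statement. [cite: KochNadirashviliSereginSverak2009, Thm 5.2 (arXiv pp. 9–10)] -/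
theorem KNSS2009_liouville_axisymmetric_no_swirl.of_pointwise
    (h52 : KNSS2009_liouville_axisymmetric_no_swirl) {u : ℝ → ℝ³ → ℝ³}
    (hu : FluidPDE.IsBoundedWeakNSSolutionOn (Iio 0) isOpen_Iio 1 u)
    (haxi : ∀ t < 0, FluidPDE.IsAxisymmetric (u t)) (hswirl : ∀ t < 0, FluidPDE.HasNoSwirl (u t)) :
    ∃ b : ℝ → ℝ, Measurable b ∧ (∃ C : ℝ, ∀ t, |b t| ≤ C) ∧
      ∀ᵐ t ∂(volume.restrict (Iio (0 : ℝ))), u t =ᵐ[volume] fun _ => b t • FluidPDE.eZ :=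
  h52 hu (ae_rotZ_of_isAxisymmetric haxi) (ae_swirl_of_hasNoSwirl hswirl)

/-- **Theorem 5.3 for a pointwise axisymmetric representative with a pointwise bound** (the
hypotheses' shape of `NS.knss_bound_C_over_r`): a special case of the printed statement. [cite: KochNadirashviliSereginSverak2009, Thm 5.3 (arXiv p. 10)] -/
theorem KNSS2009_liouville_bound_C_over_r.of_pointwise (h53 : KNSS2009_liouville_bound_C_over_r)
    {u : ℝ → ℝ³ → ℝ³} (hu : FluidPDE.IsBoundedWeakNSSolutionOn (Iio 0) isOpen_Iio 1 u)
    (haxi : ∀ t < 0, FluidPDE.IsAxisymmetric (u t))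
    (hbound : ∃ C : ℝ, ∀ t < 0, ∀ x, FluidPDE.cylRadius x * ‖u t x‖ ≤ C) :
    ∀ᵐ t ∂(volume.restrict (Iio (0 : ℝ))), u t =ᵐ[volume] 0 := by
  obtain ⟨C, hC⟩ := hbound
  exact h53 hu (ae_rotZ_of_isAxisymmetric haxi) ⟨C, ae_cylRadius_mul_norm_le_of_forall hC⟩

/-! ### Proved glue: the last step of the proof of Theorem 5.3, in both classes -/

/-- **The last line of the proof of KNSS 2009, Theorem 5.3, in the printed class.** Under
Theorem 5.2, a bounded weak solution on `ℝ³ × (−∞, 0)` which is axisymmetric *and swirl-free*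
(a.e.) and satisfies `r ‖u(t,x)‖ ≤ C` (a.e.) vanishes: `u(t, ·) = 0` a.e. for a.e. `t < 0`
(arXiv:0709.3599 p. 10: "the solution `u` is swirl-free and we can apply Theorem 5.2 to conclude
that `u = 0`"; Theorem 5.2 gives `u(t, ·) = b(t) e_z` a.e., and the decay bound forces
`b(t) = 0`, `Fluid.smul_eZ_eq_zero_of_ae_eq_of_cylRadius_mul_norm_le`). [cite: KochNadirashviliSereginSverak2009, proof of Thm 5.3, last paragraph (arXiv p. 10)] -/
theorem KNSS2009_liouville_axisymmetric_no_swirl.ae_eq_zero_of_bound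
    (h52 : KNSS2009_liouville_axisymmetric_no_swirl) {u : ℝ → ℝ³ → ℝ³}
    (hu : FluidPDE.IsBoundedWeakNSSolutionOn (Iio 0) isOpen_Iio 1 u)
    (haxi : ∀ θ : ℝ, ∀ᵐ t ∂(volume.restrict (Iio (0 : ℝ))),
      (fun x => u t (FluidPDE.rotZ θ x)) =ᵐ[volume] fun x => FluidPDE.rotZ θ (u t x))
    (hswirl : ∀ᵐ t ∂(volume.restrict (Iio (0 : ℝ))), FluidPDE.swirl (u t) =ᵐ[volume] (0 : ℝ³ → ℝ))
    (hbound : ∃ C : ℝ, ∀ᵐ t ∂(volume.restrict (Iio (0 : ℝ))), ∀ᵐ x ∂(volume : Measure ℝ³),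
      FluidPDE.cylRadius x * ‖u t x‖ ≤ C) :
    ∀ᵐ t ∂(volume.restrict (Iio (0 : ℝ))), u t =ᵐ[volume] 0 := by
  obtain ⟨b, -, -, hb⟩ := h52 hu haxi hswirl
  obtain ⟨C, hC⟩ := hbound
  filter_upwards [hb, hC] with t ht hCt
  have hβ : b t = 0 := FluidPDE.smul_eZ_eq_zero_of_ae_eq_of_cylRadius_mul_norm_le ht hCt
  filter_upwards [ht] with x hx
  simp [hx, hβ]

/-- **The last line of the proof of KNSS 2009, Theorem 5.3, in the duality-form class** of
`SelfSimilarLiouville`: under `NS.knss_axisymmetric_no_swirl` (Theorem 5.2 rendered for bounded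
ancient mild solutions), an axisymmetric swirl-free bounded ancient mild solution with measurable
slices and `r ‖u(t,x)‖ ≤ C` vanishes a.e. on every slice `t < 0` — i.e. the swirl-free case of
`NS.knss_bound_C_over_r` follows from Theorem 5.2 (arXiv:0709.3599 p. 10, last paragraph of the
proof of Theorem 5.3). [cite: KochNadirashviliSereginSverak2009, proof of Thm 5.3, last paragraph (arXiv p. 10)] -/
theorem knss_axisymmetric_no_swirl.ae_eq_zero_of_bound (h52 : knss_axisymmetric_no_swirl)
    {u : ℝ → ℝ³ → ℝ³} (hu : FluidPDE.IsBoundedAncientMildSolution 1 u)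
    (hmeas : ∀ t < 0, AEStronglyMeasurable (u t) volume)
    (haxi : ∀ t < 0, FluidPDE.IsAxisymmetric (u t)) (hswirl : ∀ t < 0, FluidPDE.HasNoSwirl (u t))
    (hbound : ∃ C : ℝ, ∀ t < 0, ∀ x, FluidPDE.cylRadius x * ‖u t x‖ ≤ C) :
    ∀ t < 0, u t =ᵐ[volume] 0 := by
  intro t ht
  obtain ⟨β, hβ⟩ := h52 hu hmeas haxi hswirl t ht
  obtain ⟨C, hC⟩ := hbound
  have h0 : β = 0 :=
    FluidPDE.smul_eZ_eq_zero_of_ae_eq_of_cylRadius_mul_norm_le hβ (Eventually.of_forall (hC t ht))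
  filter_upwards [hβ] with x hx
  simp [hx, h0]

/-- In the swirl-free case the duality-form Theorem 5.3 (`NS.knss_bound_C_over_r`) is a
consequence of the duality-form Theorem 5.2 (`NS.knss_axisymmetric_no_swirl`): packaged form of
`knss_axisymmetric_no_swirl.ae_eq_zero_of_bound` (KNSS 2009, proof of Thm 5.3, last paragraph). [cite: KochNadirashviliSereginSverak2009, proof of Thm 5.3, last paragraph (arXiv p. 10)] -/
theorem knss_bound_C_over_r_of_hasNoSwirl (h52 : knss_axisymmetric_no_swirl)
    {u : ℝ → ℝ³ → ℝ³} (hu : FluidPDE.IsBoundedAncientMildSolution 1 u)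
    (hmeas : ∀ t < 0, AEStronglyMeasurable (u t) volume)
    (haxi : ∀ t < 0, FluidPDE.IsAxisymmetric (u t))
    (hbound : ∃ C : ℝ, ∀ t < 0, ∀ x, FluidPDE.cylRadius x * ‖u t x‖ ≤ C)
    (hswirl : ∀ t < 0, FluidPDE.HasNoSwirl (u t)) : ∀ t < 0, u t =ᵐ[volume] 0 :=
  knss_axisymmetric_no_swirl.ae_eq_zero_of_bound h52 hu hmeas haxi hswirl hbound

/-- **Space–time form of the conclusion of Theorem 5.3.** For any `u` a.e. strongly measurable
on the slab (in particular a bounded weak solution), "`u(t, ·) = 0` a.e. for a.e. `t < 0`" gives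
"`u = 0` a.e. on `(−∞, 0) × ℝ³`" (Fubini–Tonelli for null sets, Mathlib
`Measure.ae_prod_iff_ae_ae` on a measurable modification); this is the literal reading of the
printed "`u = 0` in `ℝ³ × (−∞, 0)`" for `u ∈ L^∞`. [folklore] -/
theorem ae_eq_zero_slab_of_ae_slice {u : ℝ → ℝ³ → ℝ³}
    (hmeas : AEStronglyMeasurable (uncurry u) (volume.restrict (Iio (0 : ℝ) ×ˢ (univ : Set ℝ³))))
    (hslice : ∀ᵐ t ∂(volume.restrict (Iio (0 : ℝ))), u t =ᵐ[volume] 0) :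
    ∀ᵐ z ∂(volume.restrict (Iio (0 : ℝ) ×ˢ (univ : Set ℝ³))), u z.1 z.2 = 0 := by
  -- the slab measure is the product of the restricted measures
  have hprod : (volume.restrict (Iio (0 : ℝ) ×ˢ (univ : Set ℝ³)) : Measure (ℝ × ℝ³)) =
      ((volume : Measure ℝ).restrict (Iio 0)).prod ((volume : Measure ℝ³).restrict univ) := by
    rw [Measure.prod_restrict, ← Measure.volume_eq_prod]
  obtain ⟨g, hg, hug⟩ := hmeas
  rw [hprod] at hug ⊢
  -- transfer the slice statement to the measurable modification `g`
  have hgslice : ∀ᵐ t ∂((volume : Measure ℝ).restrict (Iio 0)),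
      ∀ᵐ x ∂((volume : Measure ℝ³).restrict univ), g (t, x) = 0 := by
    have h1 : ∀ᵐ t ∂((volume : Measure ℝ).restrict (Iio 0)),
        (fun x => uncurry u (t, x)) =ᵐ[(volume : Measure ℝ³).restrict univ] fun x => g (t, x) :=
      Measure.ae_ae_eq_curry_of_prod hug
    filter_upwards [hslice, h1] with t ht h1t
    rw [Measure.restrict_univ] at h1t ⊢
    filter_upwards [ht, h1t] with x hx h1x
    rw [← h1x]
    simpa using hx
  have hgset : MeasurableSet {z : ℝ × ℝ³ | g z = 0} :=
    hg.measurable (measurableSet_singleton 0)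
  have hgae : ∀ᵐ z ∂((volume : Measure ℝ).restrict (Iio 0)).prod
      ((volume : Measure ℝ³).restrict univ), g z = 0 :=
    (Measure.ae_prod_iff_ae_ae hgset).2 hgslice
  filter_upwards [hgae, hug] with z hz huz
  show uncurry u z = 0
  rw [huz]
  exact hz

/-- **Theorem 5.3, space–time form of the conclusion**: under `KNSS2009_liouville_bound_C_over_r`,
an axisymmetric bounded weak solution on `ℝ³ × (−∞, 0)` with `r‖u‖ ≤ C` vanishes a.e. on the
slab `(−∞, 0) × ℝ³` ("`u = 0` in `ℝ³ × (−∞, 0)`", arXiv:0709.3599 p. 10). [cite: KochNadirashviliSereginSverak2009, Thm 5.3 (arXiv p. 10)] -/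
theorem KNSS2009_liouville_bound_C_over_r.ae_eq_zero_slab (h53 : KNSS2009_liouville_bound_C_over_r)
    {u : ℝ → ℝ³ → ℝ³} (hu : FluidPDE.IsBoundedWeakNSSolutionOn (Iio 0) isOpen_Iio 1 u)
    (haxi : ∀ θ : ℝ, ∀ᵐ t ∂(volume.restrict (Iio (0 : ℝ))),
      (fun x => u t (FluidPDE.rotZ θ x)) =ᵐ[volume] fun x => FluidPDE.rotZ θ (u t x))
    (hbound : ∃ C : ℝ, ∀ᵐ t ∂(volume.restrict (Iio (0 : ℝ))), ∀ᵐ x ∂(volume : Measure ℝ³),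
      FluidPDE.cylRadius x * ‖u t x‖ ≤ C) :
    ∀ᵐ z ∂(volume.restrict (Iio (0 : ℝ) ×ˢ (univ : Set ℝ³))), u z.1 z.2 = 0 :=
  ae_eq_zero_slab_of_ae_slice hu.aestronglyMeasurable (h53 hu haxi hbound)

end NS

end Literature.Analysis.FluidPDE
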